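import Mathlib
import HarnessLib
import HarnessLib.Audit
import Summits.AtomisticToContinuum.Statement
import Literature.MathematicalPhysics.StatisticalMechanics.BarlowStacking
import Summits.AtomisticToContinuum.Crystallization.Theorems.ReggeStarCoercivityDefectFreeCrystallizesHullCriterion

/-!
Route: HullPeriodicPoint

CLOSED (retired) 2026-08-15T13:43:17Z by operator:999:1257524 — reason: not-a-thesis: assembly does not conclude the sub-problem Statement — note: D-0027 §2.1 audit (human 2026-08-15: routes that do not decide the summit are removed): the assembly concludes `Literature.MathematicalPhysics.StatisticalMechanics.Crystallization`, not the sub-problem statement; a NEW conforming route may be opened from the same idea (generated `closes : … → _root_. The file is kept as the record of this route; refuted decls are indexed as negative knowledge (`ledger negatives`).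

# Route HullPeriodicPoint — Hull criterion — (ii) is exactly "a periodic point in the orbit closure
of one local limit"; for LJ: layered windows at every scale + stacking periodicity in the hull

Card realised: hull-minimality-criterion. Blanc–Lewin's positional conjunct (ii) = `IsCrystallizing
lennardJones 3` asks for SOME subsequence, SOME translations and SOME periodic local limit; in
finite language this is exactly PERIODIC WINDOWS: for every sequence of LJ ground states x^N there
is ONE periodic configuration P such that for every radius R and tolerance ε, for infinitely many N,
some translate of x^N is two-way ε-matched with P.points on the ball B(0,R) ("a non-empty periodic
point lies in the orbit closure of a local limit"; support items HullCriterion /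
HullCriterionConverse certify the equivalence, using only the proved uniform minimal distance). Only
UNIFORMLY RECURRENT aperiodic order in every local limit can defeat it; isolated defects, grain
boundaries, stacking faults of density zero or even of positive but non-syndetic density are
harmless. It therefore suffices to show X = X1 ∧ X2 ∧ X3: (X1, LayeredWindows) every sequence of LJ
ground states shows, at every scale and infinitely often, windows that are rigid-motion images of a
stack of triangular layers in hole registry (free Hägg word, free interlayer spacings in [39a/50,
17a/20], in-layer spacing a ∈ [47/50, 1] — the box B of the sibling route PoissonBesselStacking);
(X2, PeriodicGivenLayered) layered windows at every scale force periodic windows at every scale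
(stacking selection inside the hull: faults are not uniformly recurrent); (X3,
CrysPeriodicMinAttained, shared stmt-0627) the periodic infimum of the energy per particle is
attained — conjunct (i) is NOT implied by a periodic point in the hull and is kept as its own crux;
E(N)/N → inf is bookkeeping (shared stmt-0626).
Lean: `LayeredWindows ∧ PeriodicGivenLayered ∧ (∃ P :
Literature.MathematicalPhysics.StatisticalMechanics.PeriodicConfiguration 3, IsLeast (Set.range fun
Q : Literature.MathematicalPhysics.StatisticalMechanics.PeriodicConfiguration 3 =>
Q.energyPerParticle Literature.MathematicalPhysics.StatisticalMechanics.lennardJones)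
(P.energyPerParticle Literature.MathematicalPhysics.StatisticalMechanics.lennardJones))`

## Assembly
Pure logic over one proved lemma: LayeredWindows and PeriodicGivenLayered give PeriodicWindows by
modus ponens per sequence; HullCriterion turns it into IsCrystallizing lennardJones 3; with
CrysPeriodicMinAttained and CrysEnergyLimit the in-tree theorem
Literature.StatMech.crystallization_of_isLeast_tendsto_isCrystallizing
(Theorems/CrystalLocalRigidityAssembly.lean; IsLeast.csInf_eq) yields
Literature.MathematicalPhysics.StatisticalMechanics.Crystallization = the sub-problem constant
`Crystallization` (checked in the planner's Sketch.lean: a 3-line term).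

Rationale: WHY THIS LINE. Mechanism (topological dynamics brought to bear on a variational statement): the set
of local limits of translated ground states is closed and translation invariant (Radin's
ground-state hull: Radin1991 §2–3, Radin2004, BellissardRadinShlosman2010 arXiv:0907.5393 Thm 1),
every closed invariant set contains minimal components (Birkhoff/Auslander: uniformly recurrent
points), and (16) of BlancLewin2015 (arXiv:1504.01153 §2.1) asks for no more than ONE periodic point
somewhere in that hull — so the whole N^{2/3}/fault-counting layer of the sibling routes
(BulkDefectVanish 0751 'all but o(N) particles', StackingFaultBound 0759 '≤ K fault planes',
RobustFejesTothHales 0758 with a linear rate) is not on the critical path of conjunct (ii):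
"frequently, somewhere, at every scale" replaces "for all but o(N) particles". Imported:
orbit-closure/minimal-set reasoning from topological dynamics and the aperiodic-order hull formalism
(Baake–Grimm, Lagarias–Pleasants repetitive Delone sets) for the reduction; 1-D long-range
lattice-gas ground states (Hägg chain, in-tree HaggStacking.lean, item 0737; LoachAckland2017;
PartayOrtnerCsanyi2017) for X2; the 3-D close-packing geometry (Hales2012, HalesDSP2012 §1.3,
FlatleyTheil2015) only for X1 and only in 'one good window' strength. What no prior route does: it
decouples (ii) from conjunct (i)'s surface bookkeeping and states both LJ cruxes in liminf
('frequently') form, the weakest form that still implies (ii); and it gives refuters an exact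
certificate format for ¬(ii) (HullCriterionConverse): ground states whose every local limit is
uniformly recurrent and aperiodic.

RANKED CRUXES. #0 PeriodicWindows (target) — PERIODIC WINDOWS (finite form of "some local limit of
translated LJ ground states has a non-empty periodic configuration in its orbit closure"): for every
sequence of Lennard-Jones ground states x^N in ℝ³ there is one periodic configuration P such that
for every R and every ε > 0, frequently in N, some translate x^N + t is two-way ε-matched with
P.points on the closed ball B(0,R) (every site of P in the ball has a particle within ε and every
particle in the ball has a site within ε). Equivalent to IsCrystallizing lennardJones 3
(HullCriterion + HullCriterionConverse). (why it might fail: False iff conjunct (ii) is false: every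
local limit of LJ ground states would have only uniformly recurrent APERIODIC minimal components
(quasicrystalline bulk or Sturmian stacking of layers at an exceptional coupling point).)
[BlancLewin2015 §2.1 (15)–(17) and §2.3 p.7, Radin1991 §2–3, BellissardRadinShlosman2010
arXiv:0907.5393 Thm 1, Radin2004]
#2 LayeredWindows (crux) — LAYERED WINDOWS (card item H2 'layering of one limit'; the genuinely 3-D
crux): for every sequence of LJ ground states x^N there is an in-layer spacing a ∈ [47/50, 1] such
that for every R and ε > 0, frequently in N, there are a linear isometry A, a translation t, a Hägg
word s (IsHaggSeq s) and layer heights z : ℤ → ℝ with all increments z(m+1) − z(m) ∈ [39a/50,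
17a/20] (the box B of route PoissonBesselStacking, so that its typed LjRegistryDomination stmt-3063
applies verbatim), such that x^N + t is two-way ε-matched on B(0,R) with the rigid image A '' S of
the layered set S = { i·u(a) + j·v(a) + L_s(m)·w(a) + z(m)·e₃ : m i j ∈ ℤ } (triangular layers of
spacing a, consecutive layers in distinct hole positions A/B/C coded by haggLabel s, FREE interlayer
spacings — so faulted and polytypic stackings with their relaxed spacings are admitted; nothing is
claimed for all but o(N) particles, only for one window per scale infinitely often). [difficulty:
XL] (why it might fail: Fails iff NO local limit of LJ ground states is layered anywhere:
polytetrahedral (Frank–Kasper-like) order or in-plane defects of positive density in every window of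
every limit, or residual strain; no theorem gives layers for a 3-D pair potential (Hales 2012 is
η=0, on unproved flyspeck_L12).) [BlancLewin2015 §2.3 p.7 ('completely open in dimension three'),
FlatleyTheil2015 arXiv:1407.0692 Thm 1.1 (fcc only with a three-body term), Hales2012
arXiv:1209.6043 Thm 1 and HalesDSP2012 §1.3 (tree: FejesTothKissingTwelve unproved named fact -
HalesDSP_layerPackings_holds proved), Literature.Barriers.AtomisticToContinuum.IcosahedralClusters,
Literature.Barriers.AtomisticToContinuum.TetrahedralFrustration, PartayOrtnerCsanyi2017
arXiv:1705.01751 p.4 (layered polytypes in LJ numerics), stmt-AtomisticToContinuum-0750 and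
stmt-AtomisticToContinuum-0758 (sibling engines K1/K2)]
#3 PeriodicGivenLayered (crux) — PERIODIC GIVEN LAYERED (card items H2/H3 'zero fault density
suffices'; stacking selection INSIDE THE HULL): for every sequence of LJ ground states, if it has
layered windows at every scale in the sense of LayeredWindows (same a, A, t, s, z data), then it has
periodic windows at every scale in the sense of PeriodicWindows (one periodic configuration P —
expected: relaxed HCP, a rotated barlowPeriodicConfiguration of the alternating word, but ANY
periodic polytype is allowed, so non-uniform relaxed spacings of longer periods do not falsify it).
Intended mechanism: Hägg domination on the box (typed: LjRegistryDomination stmt-3063 of route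
PoissonBesselStacking, margin ≥ 287 by its numerics, feeding the Peierls count
HaggDominationAllRanges stmt-0737) + cut-and-paste minimality of local limits ⇒ stacking faults have
zero density in every layered energy-minimising limit ⇒ fault-free slabs of every thickness ⇒
(exponential registry decoupling) relaxed-HCP windows of every size; only a SYNDETIC (bounded-gap)
fault pattern in every layered limit could defeat it. [deps: LayeredWindows] [difficulty: L] (why it
might fail: Fails if Hägg domination |J₂| > Σ(k−1)|J_k| breaks on the relaxed (a, spacing) band
(ratio 287–587, uncertified numerics; an exceptional coupling gives Sturmian words = Hubbard risk),
or if zero-cost faults are syndetic in EVERY layered limit (excluded only via cut-and-paste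
minimality, unproved).) [stmt-AtomisticToContinuum-3063 (LjRegistryDomination typed open - route
PoissonBesselStacking), stmt-AtomisticToContinuum-0737 (HaggDominationAllRanges typed open),
LoachAckland2017 (registry chain: H₂ dominates H₃ ⇒ hcp for LJ), PartayOrtnerCsanyi2017
arXiv:1705.01751 p.2 and p.4, Stillinger2001, BeterminPetrache2017 arXiv:1607.08716 Thm 1.1 (sign of
aligned-minus-staggered layer sums for CM weights),
Literature.Barriers.AtomisticToContinuum.Hubbard1978_mostHomogeneous,
Literature.Barriers.AtomisticToContinuum.ShortRangeStackingBlindness, Radin1991 §3a]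
#4 CrysPeriodicMinAttained (crux) — (shared item stmt-AtomisticToContinuum-0627) the infimum over
periodic configurations of ℝ³ of the Lennard-Jones energy per particle is attained by some lattice +
finite motif. Conjunct (i)'s real content; NOT implied by a periodic point in the hull (card H4: a
periodic Λ in the hull may have e(Λ) > e* on a vanishing volume fraction), hence kept as a separate
crux here; its mechanism (Hägg domination + compactness of near-optimal periodic configurations, or
an LP/three-cone certificate) is worked in the sibling routes. [difficulty: L] (why it might fail:
False iff no periodic configuration attains inf e_LJ: optimal stackings of growing period tending to
an aperiodic Barlow optimum (route RefuteCrystalPeriodicMin), i.e. Hägg domination fails at the 1e-4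
scale; print treats Bravais lattices only.) [BlancLewin2015 §2.5 p.11 and §2.3 p.7,
BeterminSamajTravenec2022 arXiv:2107.14020,
Literature.Barriers.AtomisticToContinuum.Hubbard1978_mostHomogeneous,
Literature.Barriers.AtomisticToContinuum.HcpNotBravais, stmt-AtomisticToContinuum-0737,
stmt-AtomisticToContinuum-0670]
#9 HullCriterion (support) — HULL CRITERION (card H1, soft, provable now): PeriodicWindows ⇒
IsCrystallizing lennardJones 3. Proof: Filter.extraction_of_frequently_atTop over (R, ε) = (j+1,
1/(j+1)) gives φ strictly increasing and translations τ_j; the proved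
LennardJonesMinimalDistance_holds (δ = 1/3) gives uniform separation of the translated ground
states; PeriodicConfiguration.tendsto_sum_of_eventually_near' (CrystallizationLocalLimit.lean) gives
the local convergence with multiplicity m ≡ 1. [difficulty: provable-now] [BlancLewin2015 §2.1 (16)
and §2.2, tree:
Literature.MathematicalPhysics.StatisticalMechanics.PeriodicConfiguration.tendsto_sum_of_eventually_near'
and LennardJonesMinimalDistance_holds]
#9 HullCriterionConverse (support) — CONVERSE (no loss; the negative-side certificate format):
IsCrystallizing lennardJones 3 ⇒ PeriodicWindows. Proof: along the crystallizing subsequence test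
(16) with the cone bump of radius ε at each of the finitely many sites of P in B(0,R) (limit ≥
ε·m(s) > 0 ⇒ a particle within ε, eventually) and with one continuous compactly supported g ≥ 0
vanishing exactly on the sites and ≥ 1 on {z ∈ B(0,R) : dist(z, sites) ≥ ε} (limit 0 ⇒ eventually no
unmatched particle); eventually along φ implies frequently in N. Consequently ¬PeriodicWindows
(every local limit uniformly recurrent and aperiodic) is exactly what a refutation of (ii) must
exhibit. [difficulty: provable-now] [BlancLewin2015 §2.1 (15)–(17), tree:
Literature.MathematicalPhysics.StatisticalMechanics.coneBump and not_isCrystallizing_zero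
(test-function technique)]
#9 CrysEnergyLimit (support) — (shared item stmt-AtomisticToContinuum-0626, bookkeeping) E(N)/N
converges to the infimum over periodic configurations of the LJ energy per particle in d = 3
(periodisation 0715 + trial blocks 0629 + stability 0713/0714). [difficulty: M] [BlancLewin2015 §1.3
(8)–(10), stmt-AtomisticToContinuum-0715, stmt-AtomisticToContinuum-0629,
stmt-AtomisticToContinuum-0713]

TWO-LAYER PLAN. Foreseen glued splits (not filed now; k ≤ 3, depth 1): PeriodicGivenLayered ⇐
ZeroFaultDensity (every layered local limit of LJ ground states that minimises specific energy has
stacking-fault density 0; engine: HaggDominationAllRanges 0737 on the relaxed band + a cut-and-paste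
lemma) → FaultFreeSlabsRelax (a fault-free slab of K alternating layers inside a layered equilibrium
stack is e^{-c K'}-close to relaxed HCP away from its ends: registry couplings decay like e^{-5.9
k}) → PeriodicGivenLayered (pigeonhole + rotation bookkeeping through
PeriodicConfiguration.isometryImage / translate of CrystallizationSymmetries.lean, in tree).
LayeredWindows ⇐ GoodLocalWindows (frequently, windows of every size in which every particle has a
two-shell neighbourhood ε₁-close to the cuboctahedral or anticuboctahedral pattern at one scale a:
the LJ-specific energy-to-geometry step; engines 0750-type bond counting, three-cone/LP
certificates, link census) → PatternWindowsAreLayered (fixed-tolerance propagation à la HalesDSP2012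
§1.3, whose η = 0 form HalesDSP_layerPackings_holds is PROVED in tree) → LayeredWindows (plus zero
residual strain of the chosen limit by cut-and-paste).

KILL CRITERIA. Refuting PeriodicWindows refutes conjunct (ii) itself through HullCriterionConverse:
close the route refuted:PeriodicWindows AND record ¬Crystallization. Refuting PeriodicGivenLayered
with LayeredWindows standing (layered limits whose faults are syndetic in every limit, e.g. Sturmian
stacking at an exceptional coupling) likewise refutes (ii) for LJ — close refuted. Refuting
LayeredWindows alone (no layered limit anywhere, at any scale) closes THIS route only: the hull
criterion survives and PeriodicWindows can still be fed by a non-layered structure theorem (pivot: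
local-theorem / vertex-homogeneity cards, or BulkDefectVanish 0751 ⇒ PeriodicWindows trivially).
Refutation of CrysPeriodicMinAttained (route RefuteCrystalPeriodicMin) kills conjunct (i) and the
summit conjunct. Mooted if CrystalKissingRigidity proves BulkDefectVanish + DefectVanishCrystallizes
first (then PeriodicWindows and (ii) follow and only 0627 remains, shared).

NOT DECOMPOSED YET. Deliberately not filed at open (D-0019): the two foreseen splits above; the
specific-energy functional of an infinite configuration and the cut-and-paste minimality lemma for
local limits of ground states (needed by ZeroFaultDensity; shared in spirit with cards
benjamini-schramm-ground-states A3 / hull-exactification-cascade H2 — to be defined once, when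
PeriodicGivenLayered is claimed); certified Hägg domination on the box a ∈ [0.94, 1.00], spacing/a ∈
[0.78, 0.85] (now the typed crux LjRegistryDomination stmt-3063 of route PoissonBesselStacking; this
route consumes it, does not re-file it); the rotation bookkeeping
(PeriodicConfiguration.isometryImage / translate exist in CrystallizationSymmetries.lean;
compactness of O(3) is the only extra); exclusion of residual homogeneous strain in the chosen limit
(inside LayeredWindows); rotations in (16) (not needed: translations + subsequence only).

CHEAPEST FALSIFIER. (1) Certify by interval arithmetic (kit; Bessel-tail bounds of card
poisson-bessel-stacking-selection) that J₂(a,h) < 0 and |J₂| > Σ_{k≥3}(k−1)|J_k| on a ∈ [0.94,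
1.00], h/a ∈ [0.78, 0.85] (= box B; exactly LjRegistryDomination stmt-3063): a failure inside the
sub-band actually reached by relaxed spacings would put PeriodicGivenLayered (and 0627) at an
exceptional point of the Hägg chain — the one scenario in which uniformly recurrent aperiodic
stacking is the ground state. Not run by me (planner; compute-free hub). (2) For LayeredWindows:
inspect the putative LJ global minima of the Cambridge Cluster Database / large-N basin-hopping data
for the ABSENCE of any close-packed (fcc/hcp-layered) window of 2–3 shells as N grows — known
structures (Marks decahedra, fcc/hcp cores beyond the icosahedral range) contain such windows, so a
negative finding would be news. (3) Logical: HullCriterion is provable now — if a prover finds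
PeriodicWindows does NOT imply (16) as typed (quantifier slip), the frame is wrong; my Sketch.lean
check of the assembly term guards the shape only.

NUMBERS. a* ≈ 0.9712 = (A₁₂/A₆)^{1/6} with fcc lattice sums A₁₂ = 12.132, A₆ = 14.454 (LJ r⁻¹²/12 −
r⁻⁶/6, r₀ = 1; hcp: 12.132/14.455, same to 4 digits) — inside [47/50, 1] with margin ≈ 0.03; ideal
h/a = √(2/3) = 0.8165, LJ hcp c/a ≈ 1.633 (PartayOrtnerCsanyi2017; Stillinger2001) — inside [39/50,
17/20] = [0.78, 0.85] (box B of PoissonBesselStacking); nearest interlayer distance at h = 0.78a is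
0.964a > δ. Registry couplings (card poisson-bessel-stacking-selection, uncertified): J₂ = −7.26e−5,
J₃ = −8.5e−8, J₄ ≈ −1e−10, decay e^{−5.92k}, domination ratio ∈ [287, 587] on a ∈ [0.94, 1.00], h/a
∈ [0.78, 0.85]; e_hcp − e_fcc ≈ −7.2e−5 per particle (LoachAckland2017: H₂ = −0.0009ε per layer
pair). Minimal distance δ = 1/3 (LennardJonesMinimalDistance_holds). Sturmian/most-homogeneous
words: every factor has bounded index (no u^n for all n) — the formal reason minimal aperiodic
stackings defeat (16).

DEFINITION REQUESTS. None needed to type the items (the layered set and the window matching are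
written inline over triangularVec₁/triangularVec₂/barlowOffset/layerNormal/haggLabel/IsHaggSeq of
BarlowStacking.lean and HaggStacking.lean). Foreseen support lemmas (filed by provers with
--supports, not items): points of PeriodicConfiguration.isometryImage / translate
(CrystallizationSymmetries.lean, in tree) composed with compactness of the linear isometry group;
translate/shift invariance of the layered set; Filter.extraction_of_frequently_atTop bookkeeping for
HullCriterion. If the layer-2 children are filed, a named def LayeredStacking a s z (topic
Summits/AtomisticToContinuum/Crystallization/Theorems) will replace the inline set.

Novelty: Searches (2026-08-15, this seat): lit search --hybrid "infinite volume ground state configurations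
orbit closure periodic point Lennard-Jones crystal" (8 docs: BeterminSamajTravenec2022
arXiv:2107.14020 + textbooks, nothing on hulls of finite ground states); lit vsearch "set of ground
state configurations compact translation invariant, minimal subsystems, periodic configuration in
the orbit closure" (10 books: Friedli–Velenik, Alicandro–Braides–Cicalese 2023 —
lattice/Γ-convergence, no hull criterion); zbMATH "Radin ground state" (9: Radin1991 RMP disordered
ground states via strictly ergodic systems; Radin2004 existence of ground state configurations in
ℝ^d with hard core; BellissardRadinShlosman2010 arXiv:0907.5393, READ pp.2–5: T→0 limits of Gibbs
states are supported on the GSC set G, Thm 1 — the hull/GSC formalism, no finite-N statement);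
zbMATH "Bellissard Radin Shlosman" (1); lit frontier AtomisticToContinuum --since 2020 (30 rows,
none on crystallization hulls); lit galaxy search --star all "ground state configurations dynamical
system uniquely ergodic Radin" (service queued out, 0 rows); OpenAlex/S2 rate-limited (429/0). Plus
the card's audited searches (two refuter novelty audits, grade new-combination confirmed: Radin1991
/ Radin–Wolff 1992 hull language; Baake–Grimm 2013 Prop 4.3/5.4 minimal hull ⟺ repetitive;
Auslander/Furstenberg uniformly recurrent points; Lagarias–Pleasants repetitive Delone sets; grep of
BlancLewin2015 arXiv:1504.01153 for hull/minimal/recurr  [refs: 10.1090/S0273-0979-1991-16077-5, 2107.14020, 0907.5393, 1504.01153, 1407.0692, doi:10.1090/S0273-0979-1991-16077-5, BeterminSamajTravenec2022, Radin1991, Radin2004, BellissardRadinShlosman2010, BlancLewin2015, FlatleyTheil2015]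

Barriers (technique_class: orbit-closure-minimality hagg-sequence-reduction): - technique_class: orbit-closure-minimality hagg-sequence-reduction
- Literature.Barriers.AtomisticToContinuum.Hubbard1978_mostHomogeneous: APPLIES to
PeriodicGivenLayered and CrysPeriodicMinAttained and is SHARPENED by the route: most-homogeneous
(Sturmian) words are minimal and aperiodic with bounded powers — exactly the configurations the hull
criterion cannot absorb; evaded only quantitatively and LJ-specifically: the Hägg couplings decay
like e^{−5.9k} with |J₂|/Σ(k−1)|J_k| ≈ 300 (numerics of card poisson-bessel-stacking-selection;
typed Peierls count 0737), i.e. the chain sits deep inside the period-2 plateau, not at an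
exceptional coupling; the barrier's own scope caveat (two-body convex repulsive class; the Hägg
functional is many-body, unconstrained, sign-indefinite) applies. Declared residual risk = the
route's cheapest falsifier (1).
- Literature.Barriers.AtomisticToContinuum.Hubbard1978_mostHomogeneousNarrow: same; its clause (1)
(no density constraint ⇒ locking off a null parameter set) is the regime of the stacking chain.
- Literature.Barriers.AtomisticToContinuum.KissingTwelveDegeneracy: APPLIES to LayeredWindows'
natural engine (contacts give layers, never a stacking) and is exactly respected by the split:
LayeredWindows concludes only 'layers with SOME Hägg word and free spacings'; the stacking is
selected in PeriodicGivenLayered by the r⁻⁶ tail beyond the second shell (its evasions (ii)/(iv)).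
- Literature.Barriers.AtomisticToContinuum.ShortRangeStackingBlin

History (route lifecycle, newest last):
- 2026-08-15T13:43:18Z · CLOSED retired — not-a-thesis: assembly does not conclude the sub-problem Statement (operator:999:1257524)

sub-problem: Crystallization · status: closed(retired) · opened planner-plancard-AtomisticToContinuum-Crystal-2d915526-0 2026-08-15T11:13:29Z · rev 0 · ledger route-AtomisticToContinuum-HullPeriodicPoint
GENERATED by the gate from the ledger (D-0016/17). Provers cite these decls: `theorem foo : Summit.AtomisticToContinuum.Crystallization.Theses.HullPeriodicPoint.<Decl> := …` in Summits/AtomisticToContinuum/Crystallization/Theorems/<Name>.lean.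
-/

namespace Summit.AtomisticToContinuum.Crystallization.Theses.HullPeriodicPoint

open scoped BigOperators Topology Manifold Classical MeasureTheory ProbabilityTheory Matrix InnerProductSpace ComplexConjugate ContinuousMap
open Filter Set Function TopologicalSpace MeasureTheory

attribute [summit_statement] _root_.Crystallization

/-- item stmt-AtomisticToContinuum-3240 · target · rank 0 · open · by planner
why it might fail: False iff conjunct (ii) is false: every local limit of LJ ground states would have only uniformly recurrent APERIODIC minimal components (quasicrystalline bulk or Sturmian stacking of layers at an exceptional coupling point).
sources: BlancLewin2015 §2.1 (15)–(17) and §2.3 p.7, Radin1991 §2–3, BellissardRadinShlosman2010 arXiv:0907.5393 Thm 1, Radin2004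
[target] PERIODIC WINDOWS (finite form of "some local limit of translated LJ ground states has a
non-empty periodic configuration in its orbit closure"): for every sequence of Lennard-Jones ground
states x^N in ℝ³ there is one periodic configuration P such that for every R and every ε > 0,
frequently in N, some translate x^N + t is two-way ε-matched with P.points on the closed ball B(0,R)
(every site of P in the ball has a particle within ε and every particle in the ball has a site
within ε). Equivalent to IsCrystallizing lennardJones 3 (HullCriterion + HullCriterionConverse). -/
@[route_item "route-AtomisticToContinuum-HullPeriodicPoint"]
def PeriodicWindows : Prop :=
  ∀ x : (N : ℕ) → (Fin N → EuclideanSpace ℝ (Fin 3)), (∀ N, Literature.MathematicalPhysics.StatisticalMechanics.IsGroundState Literature.MathematicalPhysics.StatisticalMechanics.lennardJones (x N)) → ∃ P : Literature.MathematicalPhysics.StatisticalMechanics.PeriodicConfiguration 3, ∀ R ε : ℝ, 0 < ε → ∃ᶠ N in Filter.atTop, ∃ t : EuclideanSpace ℝ (Fin 3), (∀ s ∈ P.points, ‖s‖ ≤ R → ∃ i : Fin N, dist (x N i + t) s ≤ ε) ∧ (∀ i : Fin N, ‖x N i + t‖ ≤ R → ∃ s ∈ P.points, dist (x N i + t) s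 ≤ ε)

/-- item stmt-AtomisticToContinuum-3241 · crux · rank 2 · closed · moot by None · by planner
why it might fail: Fails iff NO local limit of LJ ground states is layered anywhere: polytetrahedral (Frank–Kasper-like) order or in-plane defects of positive density in every window of every limit, or residual strain; no theorem gives layers for a 3-D pair potential (Hales 2012 is η=0, on unproved flyspeck_L12).
sources: BlancLewin2015 §2.3 p.7 ('completely open in dimension three'), FlatleyTheil2015 arXiv:1407.0692 Thm 1.1 (fcc only with a three-body term), Hales2012 arXiv:1209.6043 Thm 1 and HalesDSP2012 §1.3 (tree: FejesTothKissingTwelve unproved named fact - HalesDSP_layerPackings_holds proved), Literature.Barriers.AtomisticToContinuum.IcosahedralClusters, Literature.Barriers.AtomisticToContinuum.TetrahedralFrustration, PartayOrtnerCsanyi2017 arXiv:1705.01751 p.4 (layered polytypes in LJ numerics)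
[crux] LAYERED WINDOWS (card item H2 'layering of one limit'; the genuinely 3-D crux): for every
sequence of LJ ground states x^N there is an in-layer spacing a ∈ [47/50, 1] such that for every R
and ε > 0, frequently in N, there are a linear isometry A, a translation t, a Hägg word s (IsHaggSeq
s) and layer heights z : ℤ → ℝ with all increments z(m+1) − z(m) ∈ [39a/50, 17a/20] (the box B of
route PoissonBesselStacking, so that its typed LjRegistryDomination stmt-3063 applies verbatim),
such that x^N + t is two-way ε-matched on B(0,R) with the rigid image A '' S of the layered set S =
{ i·u(a) + j·v(a) + L_s(m)·w(a) + z(m)·e₃ : m i j ∈ ℤ } (triangular layers of spacing a, consecutive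
layers in distinct hole positions A/B/C coded by haggLabel s, FREE interlayer spacings — so faulted
and polytypic stackings with their relaxed spacings are admitted; nothing is claimed for all but
o(N) particles, only for one window per scale infinitely often). [difficulty: XL] -/
@[route_item "route-AtomisticToContinuum-HullPeriodicPoint"]
def LayeredWindows : Prop :=
  ∀ x : (N : ℕ) → (Fin N → EuclideanSpace ℝ (Fin 3)), (∀ N, Literature.MathematicalPhysics.StatisticalMechanics.IsGroundState Literature.MathematicalPhysics.StatisticalMechanics.lennardJones (x N)) → ∃ a : ℝ, 47 / 50 ≤ a ∧ a ≤ 1 ∧ ∀ R ε : ℝ, 0 < ε → ∃ᶠ N in Filter.atTop, ∃ (A : EuclideanSpace ℝ (Fin 3) →ₗᵢ[ℝ] EuclideanSpace ℝ (Fin 3)) (t : EuclideanSpace ℝ (Fin 3)) (s : ℤ → ℤ) (z : ℤ → ℝ), Literature.MathematicalPhysics.StatisticalMechanics.IsHaggSeq s ∧ (∀ m : ℤ, 39 / 50 * a ≤ z (m + 1) - z m ∧ z (m + 1) - z m ≤ 17 / 20 * a) ∧ let S : Set (EuclideanSpace ℝ (Fin 3)) := {p | ∃ m i j : ℤ, p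 = A (((i : ℝ) • Literature.MathematicalPhysics.StatisticalMechanics.triangularVec₁ a) + ((j : ℝ) • Literature.MathematicalPhysics.StatisticalMechanics.triangularVec₂ a) + ((Literature.MathematicalPhysics.StatisticalMechanics.haggLabel s m : ℝ) • Literature.MathematicalPhysics.StatisticalMechanics.barlowOffset a) + (z m • Literature.MathematicalPhysics.StatisticalMechanics.layerNormal 1))}; (∀ p ∈ S, ‖p‖ ≤ R → ∃ i : Fin N, dist (x N i + t) p ≤ ε) ∧ (∀ i : Fin N, ‖x N i + t‖ ≤ R → ∃ p ∈ S, dist (x N i + t) p ≤ ε)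

/-- item stmt-AtomisticToContinuum-3242 · crux · rank 3 · closed · moot by None · by planner
why it might fail: Fails if Hägg domination |J₂| > Σ(k−1)|J_k| breaks on the relaxed (a, spacing) band (ratio 287–587, uncertified numerics; an exceptional coupling gives Sturmian words = Hubbard risk), or if zero-cost faults are syndetic in EVERY layered limit (excluded only via cut-and-paste minimality, unproved).
sources: stmt-AtomisticToContinuum-3063 (LjRegistryDomination typed open - route PoissonBesselStacking), stmt-AtomisticToContinuum-0737 (HaggDominationAllRanges typed open), LoachAckland2017 (registry chain: H₂ dominates H₃ ⇒ hcp for LJ), PartayOrtnerCsanyi2017 arXiv:1705.01751 p.2 and p.4, Stillinger2001, BeterminPetrache2017 arXiv:1607.08716 Thm 1.1 (sign of aligned-minus-staggered layer sums for CM weights)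
[crux] PERIODIC GIVEN LAYERED (card items H2/H3 'zero fault density suffices'; stacking selection
INSIDE THE HULL): for every sequence of LJ ground states, if it has layered windows at every scale
in the sense of LayeredWindows (same a, A, t, s, z data), then it has periodic windows at every
scale in the sense of PeriodicWindows (one periodic configuration P — expected: relaxed HCP, a
rotated barlowPeriodicConfiguration of the alternating word, but ANY periodic polytype is allowed,
so non-uniform relaxed spacings of longer periods do not falsify it). Intended mechanism: Hägg
domination on the box (typed: LjRegistryDomination stmt-3063 of route PoissonBesselStacking, margin
≥ 287 by its numerics, feeding the Peierls count HaggDominationAllRanges stmt-0737) + cut-and-paste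
minimality of local limits ⇒ stacking faults have zero density in every layered energy-minimising
limit ⇒ fault-free slabs of every thickness ⇒ (exponential registry decoupling) relaxed-HCP windows
of every size; only a SYNDETIC (bounded-gap) fault pattern in every layered limit could defeat it.
[deps: LayeredWindows] [difficulty: L] -/
@[route_item "route-AtomisticToContinuum-HullPeriodicPoint"]
def PeriodicGivenLayered : Prop :=
  ∀ x : (N : ℕ) → (Fin N → EuclideanSpace ℝ (Fin 3)), (∀ N, Literature.MathematicalPhysics.StatisticalMechanics.IsGroundState Literature.MathematicalPhysics.StatisticalMechanics.lennardJones (x N)) → (∃ a : ℝ, 47 / 50 ≤ a ∧ a ≤ 1 ∧ ∀ R ε : ℝ, 0 < ε → ∃ᶠ N in Filter.atTop, ∃ (A : EuclideanSpace ℝ (Fin 3) →ₗᵢ[ℝ] EuclideanSpace ℝ (Fin 3)) (t : EuclideanSpace ℝ (Fin 3)) (s : ℤ → ℤ) (z : ℤ → ℝ), Literature.MathematicalPhysics.StatisticalMechanics.IsHaggSeq s ∧ (∀ m : ℤ, 39 / 50 * a ≤ z (m + 1) - z m ∧ z (m + 1) - z m ≤ 17 / 20 * a) ∧ let S : Set (EuclideanSpace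 ℝ (Fin 3)) := {p | ∃ m i j : ℤ, p = A (((i : ℝ) • Literature.MathematicalPhysics.StatisticalMechanics.triangularVec₁ a) + ((j : ℝ) • Literature.MathematicalPhysics.StatisticalMechanics.triangularVec₂ a) + ((Literature.MathematicalPhysics.StatisticalMechanics.haggLabel s m : ℝ) • Literature.MathematicalPhysics.StatisticalMechanics.barlowOffset a) + (z m • Literature.MathematicalPhysics.StatisticalMechanics.layerNormal 1))}; (∀ p ∈ S, ‖p‖ ≤ R → ∃ i : Fin N, dist (x N i + t) p ≤ ε) ∧ (∀ i : Fin N, ‖x N i + t‖ ≤ R → ∃ p ∈ S, dist (x N i + t) p ≤ ε)) → ∃ P : Literature.MathematicalPhysics.StatisticalMechanics.PeriodicConfiguration 3, ∀ R ε : ℝ, 0 < ε → ∃ᶠ N in Filter.atTop, ∃ t : EuclideanSpace ℝ (Fin 3), (∀ s ∈ P.points, ‖s‖ ≤ R → ∃ i : Fin N, dist (x N i + t) s ≤ ε) ∧ (∀ i : Fin N, ‖x N i + t‖ ≤ R → ∃ s ∈ P.points, dist (x N i + t) s ≤ ε)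

/-- item stmt-AtomisticToContinuum-0627 · crux · rank 4 · open · by planner
why it might fail: False iff no periodic configuration attains inf e_LJ: optimal stackings of growing period tending to an aperiodic Barlow optimum (route RefuteCrystalPeriodicMin), i.e. Hägg domination fails at the 1e-4 scale; print treats Bravais lattices only.
sources: BlancLewin2015 §2.5 p.11 and §2.3 p.7, BeterminSamajTravenec2022 arXiv:2107.14020, Literature.Barriers.AtomisticToContinuum.Hubbard1978_mostHomogeneous, Literature.Barriers.AtomisticToContinuum.HcpNotBravais, stmt-AtomisticToContinuum-0737, stmt-AtomisticToContinuum-0670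
The infimum over periodic configurations of ℝ³ of the Lennard-Jones energy per particle is attained
(by some lattice G and finite motif F). Needs stacking selection (c) + compactness of near-optimal
periodic configurations at bounded density / bounded-below distances; refuted if optimal LJ
stackings are aperiodic with unattained infimum (route RefuteCrystalPeriodicMin). -/
@[route_item "route-AtomisticToContinuum-HullPeriodicPoint"]
def CrysPeriodicMinAttained : Prop :=
  ∃ P : Literature.MathematicalPhysics.StatisticalMechanics.PeriodicConfiguration 3, IsLeast (Set.range fun Q : Literature.MathematicalPhysics.StatisticalMechanics.PeriodicConfiguration 3 => Q.energyPerParticle Literature.MathematicalPhysics.StatisticalMechanics.lennardJones) (P.energyPerParticle Literature.MathematicalPhysics.StatisticalMechanics.lennardJones)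

/-- item stmt-AtomisticToContinuum-0626 · support · rank 9 · open · by planner
sources: BlancLewin2015 §1.3 (8)–(10), stmt-AtomisticToContinuum-0715, stmt-AtomisticToContinuum-0629, stmt-AtomisticToContinuum-0713
Energetic crystallization: E(N)/N converges to the infimum over periodic (multi-lattice)
configurations of the LJ energy per particle in d = 3. Lower bound liminf ≥ ⨅ is the content ((a)
local optimality + (d) + surface term O(N^{2/3})); upper bound is filed separately. -/
@[route_item "route-AtomisticToContinuum-HullPeriodicPoint"]
def CrysEnergyLimit : Prop :=
  Filter.Tendsto (fun N : ℕ => Literature.MathematicalPhysics.StatisticalMechanics.groundStateEnergy Literature.MathematicalPhysics.StatisticalMechanics.lennardJones 3 N / N) Filter.atTop (nhds (⨅ Q : Literature.MathematicalPhysics.StatisticalMechanics.PeriodicConfiguration 3, Q.energyPerParticle Literature.MathematicalPhysics.StatisticalMechanics.lennardJones))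

/-- item stmt-AtomisticToContinuum-3243 · support · rank 9 · closed · proved by Summit.AtomisticToContinuum.Crystallization.Theorems.PrestressSplitKorn.stub_hullCriterion @ fa5252dfcb52 (prover) · by planner
sources: BlancLewin2015 §2.1 (16) and §2.2, tree: Literature.MathematicalPhysics.StatisticalMechanics.PeriodicConfiguration.tendsto_sum_of_eventually_near' and LennardJonesMinimalDistance_holds
[support] HULL CRITERION (card H1, soft, provable now): PeriodicWindows ⇒ IsCrystallizing
lennardJones 3. Proof: Filter.extraction_of_frequently_atTop over (R, ε) = (j+1, 1/(j+1)) gives φ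
strictly increasing and translations τ_j; the proved LennardJonesMinimalDistance_holds (δ = 1/3)
gives uniform separation of the translated ground states;
PeriodicConfiguration.tendsto_sum_of_eventually_near' (CrystallizationLocalLimit.lean) gives the
local convergence with multiplicity m ≡ 1. [difficulty: provable-now] -/
@[route_item "route-AtomisticToContinuum-HullPeriodicPoint"]
def HullCriterion : Prop :=
  PeriodicWindows → Literature.MathematicalPhysics.StatisticalMechanics.IsCrystallizing Literature.MathematicalPhysics.StatisticalMechanics.lennardJones 3

/-- `HullCriterion` holds: proved by `Summit.AtomisticToContinuum.Crystallization.Theorems.PrestressSplitKorn.stub_hullCriterion` @ fa5252dfcb52. -/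
theorem HullCriterion_holds : HullCriterion := _root_.Summit.AtomisticToContinuum.Crystallization.Theorems.PrestressSplitKorn.stub_hullCriterion

/-- item stmt-AtomisticToContinuum-3244 · support · rank 9 · closed · moot by None · by planner
sources: BlancLewin2015 §2.1 (15)–(17), tree: Literature.MathematicalPhysics.StatisticalMechanics.coneBump and not_isCrystallizing_zero (test-function technique)
[support] CONVERSE (no loss; the negative-side certificate format): IsCrystallizing lennardJones 3 ⇒
PeriodicWindows. Proof: along the crystallizing subsequence test (16) with the cone bump of radius ε
at each of the finitely many sites of P in B(0,R) (limit ≥ ε·m(s) > 0 ⇒ a particle within ε,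
eventually) and with one continuous compactly supported g ≥ 0 vanishing exactly on the sites and ≥ 1
on {z ∈ B(0,R) : dist(z, sites) ≥ ε} (limit 0 ⇒ eventually no unmatched particle); eventually along
φ implies frequently in N. Consequently ¬PeriodicWindows (every local limit uniformly recurrent and
aperiodic) is exactly what a refutation of (ii) must exhibit. [difficulty: provable-now] -/
@[route_item "route-AtomisticToContinuum-HullPeriodicPoint"]
def HullCriterionConverse : Prop :=
  Literature.MathematicalPhysics.StatisticalMechanics.IsCrystallizing Literature.MathematicalPhysics.StatisticalMechanics.lennardJones 3 → PeriodicWindows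

/-- item stmt-AtomisticToContinuum-3245 · assembly · rank 1 · closed · moot by None · by planner
sources: BlancLewin2015 §2.1, tree: Literature.StatMech.crystallization_of_isLeast_tendsto_isCrystallizing
[assembly] LayeredWindows → PeriodicGivenLayered → HullCriterion → CrysPeriodicMinAttained →
CrysEnergyLimit → Crystallization (both conjuncts). -/
@[route_item "route-AtomisticToContinuum-HullPeriodicPoint"]
def Assembly : Prop :=
  LayeredWindows → PeriodicGivenLayered → HullCriterion → CrysPeriodicMinAttained → CrysEnergyLimit → Literature.MathematicalPhysics.StatisticalMechanics.Crystallization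

end Summit.AtomisticToContinuum.Crystallization.Theses.HullPeriodicPoint
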